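import Literature.AlgebraicGeometry.Motives.HodgeLieTimesCMSummand
import Literature.AlgebraicGeometry.Motives.HodgeLieRankFourTwistedRigidity
import Literature.AlgebraicGeometry.HodgeTheory.HodgeEndomorphismsHOneOfRiemann
import Literature.AlgebraicGeometry.ComplexMultiplication.CMTypeOfSimpleSubvariety
import Summits.HodgeConjecture.CorCM.MumfordTateRankTimesCMCurve
import Summits.HodgeConjecture.CorCM.MumfordTateRankSimpleSurfaces
import HarnessLib

/-!
# `dim MT(H¹(A × S)) = dim MT(H¹A) + 2` for a SIMPLE CM abelian SURFACE `S` and `A` with imaginary quadratic `End⁰A = ℚ(√−d)`;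
# the cell simple CM surface × simple type-IV threefold: `t = 12`, and simple CM surface × Ribet type `(g−1,1)`: `t = g² + 3`
# (Moonen–Zarhin 1999 Thm. 0.2 (4) and (5.6): «`Hg(Y₁ × Y₂) = Hg(Y₁) × Hg(Y₂)` — `U_{F₁}` is `ℚ`-simple of rank `2`», for the Mumford–Tate rank)

COR-CM (cell `pub-hodgecm2`, seat `b27` gen 49, count-neutral Mumford–Tate-rank ladder; theorems only, no definition, no named fact;
UNCONDITIONAL — nothing here uses or asserts HC_CM).  Notation `t(X) = dim MT(H¹X) = dim Lie Hg(H¹X) + 1`.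

The dimension-`5` cell `X ∼ S × T` with `S` a SIMPLE abelian surface of CM type (`End⁰S = F` a quartic CM field, `t(S) = 3`,
`CorCM/MumfordTateRankSimpleSurfaces`) and `T` a simple abelian threefold with `dim_ℚ End⁰T = 2` (type IV(2,1), `t(T) = 10`) was the last
cell of the dimension-`5` table without two CM factors left open by the ladder (`CorCM/MumfordTateRankThreefoldsSharp`, `…SurfaceTimesSurface`,
`…TimesCMCurve*`: only `t ≤ 12`).  Moonen–Zarhin (5.6): «If `Y₂` is not of CM-type then Lemma (3.6) readily gives `Hg(X) = Hg(Y₁) × Hg(Y₂)`»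
— the centre of `Hg(T) = U(2,1)` is the rank-one torus `U_k`, which contains no torus isogenous to the `ℚ`-SIMPLE rank-two torus
`Hg(S) = U_{F₁}`.  In the tree's Lie-algebra language: `Motives/HodgeLieTimesCMSummand` (Lemma (3.6) for `hodgeLie` with an abelian summand:
product decomposition unless `tr((φ^*)²)·Θ_S − tr(Θ_A φ^*)·y₀ ∈ K_ℂ` along a PROPER rational `K ⊊ Lie Hg(H¹S)`) and
`Motives/HodgeLieRankFourTwistedRigidity` (no such resonance for the `H¹` of a simple CM surface, the slope `c = tr(Θ_A φ^*)/tr((φ^*)²)`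
having RATIONAL square `c² = −(n₊ − n₋)²/(d · (dim A)²)`).  The surface enters through Riemann's theorem (`End_Hdg(H¹S) ≅ End⁰(S)ᵒᵖ`,
`HodgeTheory/HodgeEndomorphismsHOneOfRiemann`): `End_Hdg(H¹S)` is commutative of dimension `4` with inverses (`End⁰S` is a division algebra,
`endAlgebra_exists_inv_of_isSimple`), and `dim Lie Hg(H¹S) = 2`.

* §1 **`finrank_hodgeLie_hodge_one_prod_cmSurface_eq_add`** — `dim Lie Hg(H¹(A × S)) = dim Lie Hg(H¹A) + dim Lie Hg(H¹S)` for `A` with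
  `0 < dim A`, `dim_ℚ End⁰A = 2`, `φ ∘ φ = −d` (`d > 0`) and `S` a simple CM surface — NO condition on the fields or on the multiplicities;
  **`mtRank_hodge_one_eq_add_two_of_isIsogenous_prod_quadraticEnd_cmSurface`** — `t(X) = t(A) + 2` for `X ∼ A × S`.
* §2 the cells: **`mtRank_hodge_one_eq_twelve_of_isIsogenous_cmSurface_prod_isSimple_threefold`** (`S × T`, `T` simple, `dim T = 3`,
  `dim_ℚ End⁰T = 2`: `t = 12 = 3 + 10 − 1`), **`mtRank_hodge_one_of_isIsogenous_cmSurface_prod_ribetTypeOne`** (`S × A`, `A` of Ribet type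
  `(g−1,1)`: `t = g² + 3`).

## References
* [MoonenZarhin1999LowDim] B. Moonen, Yu. G. Zarhin, *Hodge classes on abelian varieties of low dimension*, Math. Ann. 315 (1999), Thm. (0.2) (4),
  §2 (2.2)–(2.3), §3 Lemma (3.6)–(3.7), (5.6) [corpus: paper:arxiv-math_9901113 pp. 1–2, 5–7, 10]. [cite: MoonenZarhin1999LowDim, §3 Lemma (3.6) and (5.6)]
* [DeligneMilne1982Tannakian] P. Deligne, J. S. Milne, *Tannakian Categories*, LNM 900 (1982), §6 Thm. 6.20 (Riemann). [cite: DeligneMilne1982Tannakian, §6 Thm. 6.20]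
* [MumfordAV1970] D. Mumford, *Abelian Varieties* (1970), §19 Thm. 1 and Cor. 2 (`End⁰` of a simple abelian variety is a division algebra).
  [cite: MumfordAV1970, §19 Cor. 2 of Thm. 1]
* [Ribet1983] K. A. Ribet, Amer. J. Math. 105 (1983), Thm. 3. [cite: Ribet1983, Thm. 3]
-/

noncomputable section

open scoped TensorProduct
open CategoryTheory CategoryTheory.Limits Module

namespace Summit.HodgeConjecture.CorCM

open Literature.AlgebraicGeometry.Motives
open Literature.AlgebraicGeometry.Motives.AbelianVariety
open Literature.AlgebraicGeometry.Motives.HodgeStructure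
open Literature.AlgebraicGeometry.HodgeTheory
open Literature.AlgebraicGeometry.ComplexMultiplication
open Literature.AlgebraicGeometry.Milne1999 (IsOfCMType)

variable [HodgeTensorFacts.{0, 0}] {X A S : AbelianVariety ℂ} {n n₁ n₂ : ℕ}

/-! ## §0 The simple CM surface: `End_Hdg(H¹S)` is commutative of dimension `4` with inverses, `dim Lie Hg(H¹S) = 2` -/

/-- **The Hodge-theoretic data of a simple CM abelian surface.**  For `S` simple of dimension `2` and of CM type: `End_Hdg(H¹(S(ℂ); ℚ))`
(`= End⁰(S)ᵒᵖ` by Riemann, `mem_endAlg_hodge_one_iff_exists_bettiRep`) is commutative, every non-zero element has an inverse in it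
(`End⁰S` is a division algebra), its `ℚ`-dimension is `4` (`finrank_endAlg_hodge_one` and `mtRank_hodge_one_of_isSimple_surface`: type
IV(2,1), `dim_ℚ End⁰S = 4`), and `dim Lie Hg(H¹S) = 2` (`t(S) = 3`). [cite: MoonenZarhin1999LowDim, §2 (2.2)] [cite: DeligneMilne1982Tannakian, §6 Thm. 6.20]
[cite: MumfordAV1970, §19 Cor. 2 of Thm. 1] -/
theorem endAlg_hodge_one_data_of_isSimple_cmSurface (hS : IsSmoothProjective n₂ S.X) (hSs : S.IsSimple) (hS2 : S.dim = 2) (hScm : IsOfCMType S) :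
    haveI := BettiUniverse.finite hS 1
    (∀ a ∈ (BettiUniverse.hodge exists_isReal_hodgeModel_holds hS 1).endAlg,
        ∀ b ∈ (BettiUniverse.hodge exists_isReal_hodgeModel_holds hS 1).endAlg, a * b = b * a) ∧
      (∀ a ∈ (BettiUniverse.hodge exists_isReal_hodgeModel_holds hS 1).endAlg, a ≠ 0 →
        ∃ b ∈ (BettiUniverse.hodge exists_isReal_hodgeModel_holds hS 1).endAlg, b * a = 1) ∧
      Module.finrank ℚ (Subalgebra.toSubmodule (BettiUniverse.hodge exists_isReal_hodgeModel_holds hS 1).endAlg) = 4 ∧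
      Module.finrank ℚ (BettiUniverse.hodge exists_isReal_hodgeModel_holds hS 1).hodgeLie = 2 := by
  classical
  have hnS : S.dim = n₂ := schemeDim_eq_holds hS
  subst hnS
  haveI := BettiUniverse.finite hS 1
  have h0 : 0 < S.dim := by omega
  have h3 := (isOfCMType_iff_mtRank_hodge_one_eq_three_of_isSimple_surface hS hSs hS2).1 hScm
  -- the endomorphism algebra: type IV(2,1)
  obtain ⟨hE4, hcommS⟩ : Module.finrank ℚ S.endAlgebra = 4 ∧ ∀ x y : S.endAlgebra, x * y = y * x := by
    rcases mtRank_hodge_one_of_isSimple_surface hS hSs hS2 with ⟨-, h | h⟩ | ⟨-, h⟩ | ⟨h4, hc, -, -⟩ | ⟨-, -, h⟩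
    · omega
    · omega
    · omega
    · exact ⟨h4, hc⟩
    · omega
  have hHE := fun a => mem_endAlg_hodge_one_iff_exists_bettiRep (B := S) exists_isReal_hodgeModel_holds
    hodgePQ_independent_of_hodgeModel_holds a
  refine ⟨fun a ha b hb => ?_, fun a ha ha0 => ?_, ?_, ?_⟩
  · obtain ⟨e, rfl⟩ := (hHE a).1 ha
    obtain ⟨f, rfl⟩ := (hHE b).1 hb
    rw [← MulOpposite.unop_mul, ← MulOpposite.unop_mul, ← map_mul, ← map_mul, hcommS]
  · obtain ⟨e, rfl⟩ := (hHE a).1 ha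
    have he0 : e ≠ 0 := by
      rintro rfl
      exact ha0 (by rw [map_zero, MulOpposite.unop_zero])
    obtain ⟨y, hey, -⟩ := endAlgebra_exists_inv_of_isSimple hSs e he0
    refine ⟨MulOpposite.unop (bettiRep S y), (hHE _).2 ⟨y, rfl⟩, ?_⟩
    rw [← MulOpposite.unop_mul, ← map_mul, hey, map_one, MulOpposite.unop_one]
  · rw [Subalgebra.finrank_toSubmodule, finrank_endAlg_hodge_one exists_isReal_hodgeModel_holds hodgePQ_independent_of_hodgeModel_holds, hE4]
  · have h := mtRank_hodge_one_eq_finrank_hodgeLie_add_one hS h0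
    omega

/-! ## §1 The product theorem for `A × S` -/

/-- **`dim Lie Hg(H¹(A × S)) = dim Lie Hg(H¹A) + dim Lie Hg(H¹S)`** for `A` with `0 < dim A`, `dim_ℚ End⁰A = 2`, `φ ∘ φ = −d` (`d > 0`) and a
SIMPLE CM abelian SURFACE `S` — no condition on the fields.  The abstract `corners_mem_and_exists_linearEquiv_prod_of_abelian_of_rigid`
(`Motives/HodgeLieTimesCMSummand`) on the bicone `H¹(A × S) = fst^* H¹A ⊕ snd^* H¹S`, with skew centre `ℚφ^*` on `H¹A`
(`quadraticEnd_skewCentre_data`), `Lie Hg(H¹S)` abelian, and the twisted rigidity of `H¹S`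
(`RankFourCM.hodgeLie_le_of_theta_sub_smul_mem_spanC`) for the slope `c = tr(Θ_A φ^*)/tr((φ^*)²)`, `c² = −(n₊ − n₋)²/(d (dim A)²) ∈ ℚ`
(`trace_theta_mul_baseChange_pullback_eq`, `trace_pullback_mul_self_eq`).  Moonen–Zarhin (5.6)/(3.6): «`Hg(Y₁ × Y₂) = Hg(Y₁) × Hg(Y₂)`».
[cite: MoonenZarhin1999LowDim, §3 Lemma (3.6) and (5.6)] [cite: DeligneMilne1982Tannakian, §6 Thm. 6.20] -/
theorem finrank_hodgeLie_hodge_one_prod_cmSurface_eq_add (hA : IsSmoothProjective n₁ A.X) (hS : IsSmoothProjective n₂ S.X)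
    {m : ℕ} (hP : IsSmoothProjective m (A.prod S).X) (hA0 : 0 < A.dim) (hA2 : Module.finrank ℚ A.endAlgebra = 2)
    (φ : A ⟶ A) {d : ℕ} (hd : 0 < d) (hφ : φ ≫ φ = -(d • 𝟙 A)) (hSs : S.IsSimple) (hS2 : S.dim = 2) (hScm : IsOfCMType S) :
    haveI := BettiUniverse.finite hP 1
    haveI := BettiUniverse.finite hA 1
    haveI := BettiUniverse.finite hS 1
    Module.finrank ℚ (BettiUniverse.hodge exists_isReal_hodgeModel_holds hP 1).hodgeLie =
      Module.finrank ℚ (BettiUniverse.hodge exists_isReal_hodgeModel_holds hA 1).hodgeLie +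
        Module.finrank ℚ (BettiUniverse.hodge exists_isReal_hodgeModel_holds hS 1).hodgeLie := by
  classical
  have hnA : A.dim = n₁ := schemeDim_eq_holds hA
  have hnS : S.dim = n₂ := schemeDim_eq_holds hS
  subst hnA hnS
  haveI := BettiUniverse.finite hP 1
  haveI := BettiUniverse.finite hA 1
  haveI := BettiUniverse.finite hS 1
  -- the bicone of `H¹`
  let ι₁ := BettiUniverse.pullHodgeHom exists_isReal_hodgeModel_holds hodgePQ_independent_of_hodgeModel_holds hP hA
    (fst A S).hom.hom.hom 1
  let π₁ := BettiUniverse.pullHodgeHom exists_isReal_hodgeModel_holds hodgePQ_independent_of_hodgeModel_holds hA hP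
    (prodLift (𝟙 A) (0 : A ⟶ S)).hom.hom.hom 1
  let ι₂ := BettiUniverse.pullHodgeHom exists_isReal_hodgeModel_holds hodgePQ_independent_of_hodgeModel_holds hP hS
    (snd A S).hom.hom.hom 1
  let π₂ := BettiUniverse.pullHodgeHom exists_isReal_hodgeModel_holds hodgePQ_independent_of_hodgeModel_holds hS hP
    (prodLift (0 : S ⟶ A) (𝟙 S)).hom.hom.hom 1
  have hsumP : fst A S ≫ prodLift (𝟙 A) (0 : A ⟶ S) + snd A S ≫ prodLift (0 : S ⟶ A) (𝟙 S) = 𝟙 _ := by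
    refine prod_hom_ext ?_ ?_
    · rw [Preadditive.add_comp, Category.assoc, Category.assoc, prodLift_fst, prodLift_fst, Category.comp_id,
        comp_zero, add_zero, Category.id_comp]
    · rw [Preadditive.add_comp, Category.assoc, Category.assoc, prodLift_snd, prodLift_snd, Category.comp_id,
        comp_zero, zero_add, Category.id_comp]
  have hπι₁ : ∀ v, π₁.toLinearMap (ι₁.toLinearMap v) = v := fun v => pull_pull_eq_self_of_comp_eq_id (prodLift_fst _ _) v
  have hπι₂ : ∀ v, π₂.toLinearMap (ι₂.toLinearMap v) = v := fun v => pull_pull_eq_self_of_comp_eq_id (prodLift_snd _ _) v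
  have hsum : ∀ v, ι₁.toLinearMap (π₁.toLinearMap v) + ι₂.toLinearMap (π₂.toLinearMap v) = v := fun v =>
    pull_pull_add_pull_pull_eq_self _ _ _ _ hsumP v
  -- polarizations, Hodge operators
  obtain ⟨ψ⟩ := BettiUniverse.hodge_isPolarizable exists_isReal_hodgeModel_holds hP 1
  obtain ⟨ψ₁⟩ := BettiUniverse.hodge_isPolarizable exists_isReal_hodgeModel_holds hA 1
  obtain ⟨ψ₂⟩ := BettiUniverse.hodge_isPolarizable exists_isReal_hodgeModel_holds hS 1
  obtain ⟨Θ₁, hΘ₁⟩ := exists_hodgeTheta (BettiUniverse.hodge exists_isReal_hodgeModel_holds hA 1)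
  obtain ⟨Θ₂, hΘ₂⟩ := exists_hodgeTheta (BettiUniverse.hodge exists_isReal_hodgeModel_holds hS 1)
  -- the data on `A`: `φ^*` and the skew centre `ℚφ^*`
  obtain ⟨hφE, hφ2, hZ⟩ := quadraticEnd_skewCentre_data exists_isReal_hodgeModel_holds hodgePQ_independent_of_hodgeModel_holds hA0 hA2
    hd hφ ψ₁
  -- the data on `S`
  obtain ⟨hcommE, hinvE, hE4, h𝔥2⟩ := endAlg_hodge_one_data_of_isSimple_cmSurface hS hSs hS2 hScm
  have heff₂ := BettiUniverse.hodge_isEffective exists_isReal_hodgeModel_holds hS 1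
  have hV₂ : Module.finrank ℚ (bettiCohomology S.X 1) = 4 := by rw [finrank_bettiCohomology_one S, hS2]
  have h𝔥F := hodgeLie_le_endAlg_of_finrank_hodgeLie_le_two (BettiUniverse.hodge exists_isReal_hodgeModel_holds hS 1) h𝔥2.le
  have hab₂ : ∀ a ∈ (BettiUniverse.hodge exists_isReal_hodgeModel_holds hS 1).hodgeLie,
      ∀ b ∈ (BettiUniverse.hodge exists_isReal_hodgeModel_holds hS 1).hodgeLie, a * b = b * a := fun a ha b hb =>
    hcommE a ((Subalgebra.mem_toSubmodule _).1 (h𝔥F ha)) b ((Subalgebra.mem_toSubmodule _).1 (h𝔥F hb))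
  -- the slope `c = tr(Θ_A φ^*) / tr((φ^*)²)` has rational square
  set T : ℚ := LinearMap.trace ℚ _ ((bettiCohomology.map φ.hom.hom.hom 1).hom * (bettiCohomology.map φ.hom.hom.hom 1).hom) with hTdef
  set Sc : ℂ := LinearMap.trace ℂ _ (Θ₁ * (bettiCohomology.map φ.hom.hom.hom 1).hom.baseChange ℂ) with hScdef
  have hT : T = -((d : ℚ) * (2 * A.dim)) := trace_pullback_mul_self_eq φ hφ
  have hT0 : (T : ℂ) ≠ 0 := by
    have h : T ≠ 0 := by
      rw [hT]
      have hdQ : (d : ℚ) ≠ 0 := by exact_mod_cast hd.ne'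
      have hdim : ((A.dim : ℕ) : ℚ) ≠ 0 := by exact_mod_cast hA0.ne'
      exact neg_ne_zero.2 (mul_ne_zero hdQ (mul_ne_zero two_ne_zero hdim))
    exact_mod_cast h
  have hSc : Sc = 2 * (Complex.I * (Real.sqrt d : ℂ)) *
      ((eigenMultiplicity A φ (Complex.I * (Real.sqrt d : ℂ)) : ℂ) - (eigenMultiplicity A φ (-(Complex.I * (Real.sqrt d : ℂ))) : ℂ)) :=
    trace_theta_mul_baseChange_pullback_eq exists_isReal_hodgeModel_holds hodgePQ_independent_of_hodgeModel_holds φ hd hφ hΘ₁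
  set q : ℚ := -(((eigenMultiplicity A φ (Complex.I * (Real.sqrt d : ℂ)) : ℚ) -
      (eigenMultiplicity A φ (-(Complex.I * (Real.sqrt d : ℂ))) : ℚ)) ^ 2 / ((d : ℚ) * ((A.dim : ℚ) * A.dim))) with hqdef
  have hsd : (Real.sqrt d : ℂ) * (Real.sqrt d : ℂ) = (d : ℂ) := by
    rw [← Complex.ofReal_mul, Real.mul_self_sqrt (Nat.cast_nonneg d), Complex.ofReal_natCast]
  have hcq : (Sc / T) * (Sc / T) = (q : ℂ) := by
    have hdC : (d : ℂ) ≠ 0 := by exact_mod_cast hd.ne'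
    have hgC : ((A.dim : ℕ) : ℂ) ≠ 0 := by exact_mod_cast hA0.ne'
    have hScSc : Sc * Sc = -(4 * (d : ℂ) *
        (((eigenMultiplicity A φ (Complex.I * (Real.sqrt d : ℂ)) : ℂ) - (eigenMultiplicity A φ (-(Complex.I * (Real.sqrt d : ℂ))) : ℂ)) ^ 2)) := by
      rw [hSc]
      have h : (2 * (Complex.I * (Real.sqrt d : ℂ))) * (2 * (Complex.I * (Real.sqrt d : ℂ))) = -(4 * (d : ℂ)) := by
        calc (2 * (Complex.I * (Real.sqrt d : ℂ))) * (2 * (Complex.I * (Real.sqrt d : ℂ)))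
            = 4 * (Complex.I * Complex.I) * ((Real.sqrt d : ℂ) * (Real.sqrt d : ℂ)) := by ring
          _ = -(4 * (d : ℂ)) := by rw [Complex.I_mul_I, hsd]; ring
      linear_combination
        (((eigenMultiplicity A φ (Complex.I * (Real.sqrt d : ℂ)) : ℂ) - (eigenMultiplicity A φ (-(Complex.I * (Real.sqrt d : ℂ))) : ℂ)) ^ 2) * h
    rw [div_mul_div_comm, hScSc, hT, hqdef]
    push_cast
    field_simp
    ring
  -- twisted rigidity of `H¹S` for this slope
  have hrig : ∀ K : Submodule ℚ (Module.End ℚ (bettiCohomology S.X 1)), K ≤ (BettiUniverse.hodge exists_isReal_hodgeModel_holds hS 1).hodgeLie →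
      ∀ y₀ ∈ (BettiUniverse.hodge exists_isReal_hodgeModel_holds hS 1).hodgeLie,
        ((T : ℚ) : ℂ) • Θ₂ - Sc • y₀.baseChange ℂ ∈ spanC K → (BettiUniverse.hodge exists_isReal_hodgeModel_holds hS 1).hodgeLie ≤ K := by
    intro K hK y₀ hy₀ hmem
    have hmem' : Θ₂ - (Sc / T) • y₀.baseChange ℂ ∈ spanC K := by
      have h := Submodule.smul_mem _ ((T : ℂ)⁻¹) hmem
      rw [smul_sub, smul_smul, inv_mul_cancel₀ hT0, one_smul, smul_smul] at h
      rwa [div_eq_inv_mul]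
    exact RankFourCM.hodgeLie_le_of_theta_sub_smul_mem_spanC (BettiUniverse.hodge exists_isReal_hodgeModel_holds hS 1) Nat.cast_one heff₂ ψ₂
      hΘ₂ hV₂ hcommE hinvE hE4 h𝔥2 hy₀ K hK hcq hmem'
  exact (corners_mem_and_exists_linearEquiv_prod_of_abelian_of_rigid ι₁ π₁ ι₂ π₂ hπι₁ hπι₂ hsum ψ ψ₁ hφE hZ hab₂ hΘ₁ hΘ₂ hrig).2.2.2

/-- **`t(X) = t(A) + 2` for `X ∼ A × S`**, `A` with `0 < dim A`, `dim_ℚ End⁰A = 2`, `φ ∘ φ = −d`, and `S` a SIMPLE CM abelian surface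
(`t(A × S) + 1 = t(A) + t(S)` with `t(S) = 3`): Moonen–Zarhin's «`Hg(X₁ × X₂) = Hg(X₁) × Hg(X₂)`» for an imaginary-quadratic centre against the
`ℚ`-simple rank-two torus `U_F = Hg(S)`. [cite: MoonenZarhin1999LowDim, §3 Lemma (3.6) and (5.6)] -/
theorem mtRank_hodge_one_eq_add_two_of_isIsogenous_prod_quadraticEnd_cmSurface (hX : IsSmoothProjective n X.X)
    (hA : IsSmoothProjective n₁ A.X) (hA0 : 0 < A.dim) (hA2 : Module.finrank ℚ A.endAlgebra = 2) (φ : A ⟶ A) {d : ℕ} (hd : 0 < d)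
    (hφ : φ ≫ φ = -(d • 𝟙 A)) (hSs : S.IsSimple) (hS2 : S.dim = 2) (hScm : IsOfCMType S) (hXP : IsIsogenous X (A.prod S)) :
    haveI := BettiUniverse.finite hX 1
    haveI := BettiUniverse.finite hA 1
    (BettiUniverse.hodge exists_isReal_hodgeModel_holds hX 1).mtRank = (BettiUniverse.hodge exists_isReal_hodgeModel_holds hA 1).mtRank + 2 := by
  have hS : IsSmoothProjective S.dim S.X := AbelianVariety.isSmoothProjective_holds
  have hP : IsSmoothProjective (A.prod S).dim (A.prod S).X := AbelianVariety.isSmoothProjective_holds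
  haveI := BettiUniverse.finite hX 1
  haveI := BettiUniverse.finite hA 1
  haveI := BettiUniverse.finite hS 1
  haveI := BettiUniverse.finite hP 1
  have h0 : 0 < X.dim := by
    obtain ⟨f, hf⟩ := hXP
    rw [dim_eq_of_isIsogeny hf, dim_prod]; omega
  have h := finrank_hodgeLie_hodge_one_prod_cmSurface_eq_add hA hS hP hA0 hA2 φ hd hφ hSs hS2 hScm
  obtain ⟨-, -, -, h2⟩ := endAlg_hodge_one_data_of_isSimple_cmSurface hS hSs hS2 hScm
  rw [← finrank_hodgeLie_hodge_one_eq_of_isIsogenous hX hP hXP, h2] at h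
  rw [mtRank_hodge_one_eq_finrank_hodgeLie_add_one hX h0, mtRank_hodge_one_eq_finrank_hodgeLie_add_one hA hA0]
  omega

/-! ## §2 The cells: simple CM surface × simple type-IV threefold, and × Ribet type `(g−1,1)` -/

/-- **Simple CM SURFACE × simple abelian THREEFOLD with (imaginary) quadratic `End⁰T`: `t = 12`** — Moonen–Zarhin Thm. (0.2) (4) for the
partition `{2, 3}` with exactly one CM factor: `X ∼ S × T`, `S` simple of CM type (`t(S) = 3`), `T` simple with `dim_ℚ End⁰T = 2` (type IV(2,1),
`t(T) = 10`): `dim MT(H¹X) = 12 = t(S) + t(T) − 1`, `Hg(X) = Hg(S) × Hg(T) = U_F × U(2,1)`, WHATEVER the quartic CM field `F` and the imaginary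
quadratic field `k` ((5.6): «if `Y₂` is not of CM-type then Lemma (3.6) readily gives `Hg(X) = Hg(Y₁) × Hg(Y₂)`»).  With `CorCM/MumfordTateRankThreefoldsSharp`
and the other product files this closes the dimension-`5` cells with at most one CM factor.
[cite: MoonenZarhin1999LowDim, Thm. (0.2) (4) and (5.6)] [cite: MoonenZarhin1999LowDim, §2 (2.2)–(2.3)] -/
theorem mtRank_hodge_one_eq_twelve_of_isIsogenous_cmSurface_prod_isSimple_threefold (hX : IsSmoothProjective n X.X)
    {T : AbelianVariety ℂ} (hSs : S.IsSimple) (hS2 : S.dim = 2) (hScm : IsOfCMType S) (hTs : T.IsSimple) (hT3 : T.dim = 3)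
    (hTE : Module.finrank ℚ T.endAlgebra = 2) (hXP : IsIsogenous X (S.prod T)) :
    haveI := BettiUniverse.finite hX 1
    (BettiUniverse.hodge exists_isReal_hodgeModel_holds hX 1).mtRank = 12 := by
  classical
  have hT : IsSmoothProjective T.dim T.X := AbelianVariety.isSmoothProjective_holds
  haveI := BettiUniverse.finite hX 1
  haveI := BettiUniverse.finite hT 1
  have h0 : 0 < T.dim := by omega
  -- `End⁰T = ℚ(φ)`, `φ ∘ φ = −d`
  have hF : IsField T.endAlgebra := AbelianVariety.isField_endAlgebra_of_isSimple_of_finrank_eq_two hTs h0 hTE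
  have hnR : ¬ NumberField.IsTotallyReal (EndField T hF) := fun hR => by
    have h := finrank_endAlgebra_dvd_dim_of_isField_of_isTotallyReal hF h0 hR
    rw [hTE, hT3] at h
    omega
  obtain ⟨a, q, hq, ha⟩ := AbelianVariety.exists_mul_self_eq_neg_of_finrank_eq_two h0 hTE hF hnR
  obtain ⟨φ, d, hd, hφ⟩ := AbelianVariety.exists_hom_comp_self_eq_neg T hq ha
  have h10 : (BettiUniverse.hodge exists_isReal_hodgeModel_holds hT 1).mtRank = 10 :=
    (mtRank_hodge_one_of_isSimple_threefold_of_finrank_endAlgebra_eq_two hT hTs hT3 hTE).1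
  have h := mtRank_hodge_one_eq_add_two_of_isIsogenous_prod_quadraticEnd_cmSurface hX hT h0 hTE φ hd hφ hSs hS2 hScm
    (hXP.trans (isIsogenous_prod_comm S T))
  omega

/-- **Simple CM surface × Ribet type `(g − 1, 1)`: `t = g² + 3`.**  `A` of dimension `g ≥ 3` with `End⁰A` a field of `ℚ`-dimension `2` that is not
totally real, `φ ∘ φ = −d` with multiplicity one at `i√d` or at `−i√d` on `H^{1,0}(A)` (`t(A) = g² + 1`, `CorCM/MumfordTateRankRibetTypeOne`), `S` a
simple CM surface: `dim MT(H¹(S × A)) = g² + 3` (`Hg = U_F × U(g−1,1)`), for EVERY pair of fields. [cite: MoonenZarhin1999LowDim, §3 Lemma (3.6)]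
[cite: Ribet1983, Thm. 3] -/
theorem mtRank_hodge_one_of_isIsogenous_cmSurface_prod_ribetTypeOne (hX : IsSmoothProjective n X.X) (hSs : S.IsSimple) (hS2 : S.dim = 2)
    (hScm : IsOfCMType S) (hF : IsField A.endAlgebra) (hnR : ¬ NumberField.IsTotallyReal (EndField A hF)) (φ : A ⟶ A) {d : ℕ}
    (hd : 0 < d) (hφ : φ ≫ φ = -(d • 𝟙 A)) (hA2 : Module.finrank ℚ A.endAlgebra = 2)
    (h1 : eigenMultiplicity A φ (Complex.I * (Real.sqrt d : ℂ)) = 1 ∨ eigenMultiplicity A φ (-(Complex.I * (Real.sqrt d : ℂ))) = 1)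
    (hdim : 3 ≤ A.dim) (hXP : IsIsogenous X (S.prod A)) :
    haveI := BettiUniverse.finite hX 1
    (BettiUniverse.hodge exists_isReal_hodgeModel_holds hX 1).mtRank = A.dim * A.dim + 3 := by
  have hA : IsSmoothProjective A.dim A.X := AbelianVariety.isSmoothProjective_holds
  haveI := BettiUniverse.finite hX 1
  haveI := BettiUniverse.finite hA 1
  have hgg := (mtRank_hodge_one_of_ribetTypeOne' hA hF hnR φ hd hφ hA2 h1 hdim).1
  have h := mtRank_hodge_one_eq_add_two_of_isIsogenous_prod_quadraticEnd_cmSurface hX hA (by omega) hA2 φ hd hφ hSs hS2 hScm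
    (hXP.trans (isIsogenous_prod_comm S A))
  omega

end Summit.HodgeConjecture.CorCM

end
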